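import Summits.Parity.BatemanHorn.Theorems.SoloInformedTwinBoxClassTotals
import Summits.Parity.BatemanHorn.Theorems.SoloInformedTwinBoxFreeInput
import Summits.Parity.BatemanHorn.Theorems.SoloInformedTwinUnbalancedLite

/-!
# The unbalanced twin sum, regime (1b) — VII: the large-cofactor bound (F4c main theorem)

Soloist file (informed mode), file F4c-β3 of the kernel project for (F′).  For the switched
class sums of `SoloInformedTwinUnbalancedSmallClass` (`innerP j r₀ lo hi y a q k`: the `e`-sum
of the Möbius log-power piece `μ(e)𝟙[(e,r₀)=1] log^j e` over `y/q < e ≤ hi/k`, `ke ≡ a (q)`) we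
prove, for every `A > 0`, the LARGE-COFACTOR estimate

  `∑_{q ≤ z} |∑_{K₀ < k ≤ K, (k,r₀)=1} innerP(q, k)| ≤ C X / (log X)^A`

whenever `hi ≤ X`, `K₀ ≥ X^{4ε'}`, `z² (log X)^{B'} ≤ y ≤ X` and `2z X^{ε'} ≤ y`
(`sum_abs_innerP_large_le`).  There is NO upper constraint on `K` and none on the size of `z`
relative to `hi` beyond `z² (log X)^{B'} ≤ y`: this is what removes the restriction `3ε₀ > 1/2 + ε`
of the lite assembly.  Proof = the `(1+Δ)`-adic box decomposition of F4a with `Δ = (log X)^{-n}`,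
the four-class bound of F4c-α, the class totals of F4c-β1/β2 (classes T, P, H by counting) and
the Bombieri–Friedlander–Iwaniec bound on the free class (F4b via `free_box_input`), followed by
bookkeeping of powers of `log X` (§1).
-/

namespace Summit.Parity.BatemanHorn.Theorems

open Finset Real Filter
open scoped ArithmeticFunction.Moebius
open Literature.NumberTheory.Sieve Literature.NumberTheory.Sieve.BFI

/-! ### 1. Bookkeeping of powers of `L = log X` (`Δ = 1/L^n`, `n = m + j + 3`) -/

/-- The number of `e`-boxes: `⌊2t/Δ⌋₊ + 1 ≤ 3 L^{n+1}` for `0 ≤ t ≤ L`, `Δ = 1/L^n`. -/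
theorem boxCount_le_of {L Δ t : ℝ} {n : ℕ} (hL : 1 ≤ L) (hΔ : Δ = (L ^ n)⁻¹) (ht0 : 0 ≤ t)
    (ht : t ≤ L) : ((⌊2 * t / Δ⌋₊ + 1 : ℕ) : ℝ) ≤ 3 * L ^ (n + 1) := by
  have hL0 : 0 < L := by linarith
  have hLn : 1 ≤ L ^ n := one_le_pow₀ hL
  have h0 : 0 ≤ 2 * t / Δ := by rw [hΔ]; positivity
  have h1 : (⌊2 * t / Δ⌋₊ : ℝ) ≤ 2 * L * L ^ n :=
    calc (⌊2 * t / Δ⌋₊ : ℝ) ≤ 2 * t / Δ := Nat.floor_le h0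
      _ = 2 * t * L ^ n := by rw [hΔ, div_inv_eq_mul]
      _ ≤ 2 * L * L ^ n := by nlinarith
  push_cast
  rw [pow_succ]
  nlinarith

/-- Class T: `4V (log hi)^j (Δ I' (1+log z) + 8/Δ) ≤ 56 V L^{j+n}`. -/
theorem classT_numeric_le {L Δ V Lh lz I' : ℝ} {j n : ℕ} (hL : 1 ≤ L) (hn : 2 ≤ n)
    (hΔ : Δ = (L ^ n)⁻¹) (hV : 0 ≤ V) (hLh0 : 0 ≤ Lh) (hLh : Lh ≤ L) (hlz0 : 0 ≤ lz)
    (hlz : 1 + lz ≤ 2 * L) (hI'0 : 0 ≤ I') (hI' : I' ≤ 3 * L ^ (n + 1)) :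
    4 * V * Lh ^ j * (Δ * I' * (1 + lz) + 8 / Δ) ≤ 56 * V * L ^ (j + n) := by
  have hL0 : 0 < L := by linarith
  have hLn0 : 0 < L ^ n := by positivity
  have hΔ0 : 0 < Δ := by rw [hΔ]; positivity
  have hΔL : Δ * L ^ n = 1 := by rw [hΔ]; exact inv_mul_cancel₀ hLn0.ne'
  have hΔI : Δ * I' ≤ 3 * L :=
    calc Δ * I' ≤ Δ * (3 * L ^ (n + 1)) := mul_le_mul_of_nonneg_left hI' hΔ0.le
      _ = 3 * L * (Δ * L ^ n) := by rw [pow_succ]; ring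
      _ = 3 * L := by rw [hΔL, mul_one]
  have h8 : 8 / Δ = 8 * L ^ n := by rw [hΔ, div_inv_eq_mul]
  have hL2n : L ^ 2 ≤ L ^ n := pow_le_pow_right₀ hL hn
  have hbr : Δ * I' * (1 + lz) + 8 / Δ ≤ 14 * L ^ n := by
    have h1 : Δ * I' * (1 + lz) ≤ 3 * L * (2 * L) :=
      mul_le_mul hΔI hlz (by linarith) (by linarith)
    rw [h8]; nlinarith
  have hbr0 : 0 ≤ Δ * I' * (1 + lz) + 8 / Δ := by positivity
  have hLhj : Lh ^ j ≤ L ^ j := pow_le_pow_left₀ hLh0 hLh j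
  calc 4 * V * Lh ^ j * (Δ * I' * (1 + lz) + 8 / Δ)
      ≤ 4 * V * L ^ j * (14 * L ^ n) :=
        mul_le_mul (mul_le_mul_of_nonneg_left hLhj (by positivity)) hbr hbr0 (by positivity)
    _ = 56 * V * L ^ (j + n) := by rw [pow_add]; ring

/-- Class T, the two parts of `V = X^{1/2} + z² L^{2n₁}`: `56 V L^{j+n} ≤ 57 X / L^m`. -/
theorem classT_split_le {L X S zz y : ℝ} {j n m n₁ : ℕ} (hL : 1 ≤ L) (hy : y ≤ X)
    (hS : 56 * S * L ^ (j + n + m) ≤ X) (hzy : zz * L ^ (2 * n₁ + j + n + m) ≤ y) :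
    56 * (S + zz * L ^ (2 * n₁)) * L ^ (j + n) ≤ 57 * X / L ^ m := by
  have hL0 : 0 < L := by linarith
  have hLm0 : 0 < L ^ m := by positivity
  rw [le_div_iff₀ hLm0]
  have e1 : 56 * (S + zz * L ^ (2 * n₁)) * L ^ (j + n) * L ^ m
      = 56 * S * L ^ (j + n + m) + 56 * (zz * L ^ (2 * n₁ + j + n + m)) := by
    rw [show 2 * n₁ + j + n + m = 2 * n₁ + (j + n + m) by omega, pow_add L (2 * n₁),
      pow_add L (j + n) m]
    ring
  rw [e1]
  linarith

/-- Class P: `4 hi (log hi)^j (Δ(1+log z) + 4z²/y) ≤ 24 X / L^m`. -/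
theorem classP_numeric_le {L Δ X hi Lh lz zz y : ℝ} {j n m : ℕ} (hL : 1 ≤ L)
    (hn : n = m + j + 3) (hΔ : Δ = (L ^ n)⁻¹) (hX : 0 ≤ X) (hhi : hi ≤ X)
    (hLh0 : 0 ≤ Lh) (hLh : Lh ≤ L) (hlz0 : 0 ≤ lz) (hlz : 1 + lz ≤ 2 * L) (hy : 0 < y)
    (hzz0 : 0 ≤ zz) (hzy : zz * L ^ (j + m) ≤ y) :
    4 * hi * Lh ^ j * (Δ * (1 + lz) + 4 * zz / y) ≤ 24 * X / L ^ m := by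
  have hL0 : 0 < L := by linarith
  have hLm0 : 0 < L ^ m := by positivity
  have hLn0 : 0 < L ^ n := by positivity
  have hΔ0 : 0 < Δ := by rw [hΔ]; positivity
  have hLhj : Lh ^ j ≤ L ^ j := pow_le_pow_left₀ hLh0 hLh j
  have hb : L ^ j * (Δ * (1 + lz)) ≤ 2 / L ^ m := by
    have e1 : L ^ j * (Δ * (1 + lz)) = L ^ j * (1 + lz) / L ^ n := by rw [hΔ]; ring
    rw [e1, div_le_div_iff₀ hLn0 hLm0]
    have e2 : L ^ n = L ^ j * L ^ m * (L ^ 2 * L) := by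
      rw [hn, show m + j + 3 = j + m + (2 + 1) by omega, pow_add, pow_add, pow_add, pow_one]
    rw [e2]
    have hjm : 0 ≤ L ^ j * L ^ m := by positivity
    have h3 : 1 + lz ≤ 2 * (L ^ 2 * L) := hlz.trans (by nlinarith [one_le_pow₀ (n := 2) hL])
    nlinarith [mul_le_mul_of_nonneg_left h3 hjm]
  have hc : L ^ j * (4 * zz / y) ≤ 4 / L ^ m := by
    rw [mul_div_assoc', div_le_div_iff₀ hy hLm0]
    have : zz * (L ^ j * L ^ m) ≤ y := by rw [← pow_add]; exact hzy
    nlinarith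
  have hbr0 : 0 ≤ Δ * (1 + lz) + 4 * zz / y := by positivity
  calc 4 * hi * Lh ^ j * (Δ * (1 + lz) + 4 * zz / y)
      ≤ 4 * X * L ^ j * (Δ * (1 + lz) + 4 * zz / y) := by
        refine mul_le_mul_of_nonneg_right ?_ hbr0
        exact mul_le_mul (mul_le_mul_of_nonneg_left hhi (by norm_num)) hLhj (by positivity)
          (by positivity)
    _ = 4 * X * (L ^ j * (Δ * (1 + lz)) + L ^ j * (4 * zz / y)) := by ring
    _ ≤ 4 * X * (2 / L ^ m + 4 / L ^ m) :=
        mul_le_mul_of_nonneg_left (add_le_add hb hc) (by positivity)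
    _ = 24 * X / L ^ m := by ring

/-- Class H: `4 hi (log hi)^j (Δ² I' (1+log z) + 4z²/y) ≤ 40 X / L^m`. -/
theorem classH_numeric_le {L Δ X hi Lh lz zz y I' : ℝ} {j n m : ℕ} (hL : 1 ≤ L)
    (hn : n = m + j + 3) (hΔ : Δ = (L ^ n)⁻¹) (hX : 0 ≤ X) (hhi : hi ≤ X)
    (hLh0 : 0 ≤ Lh) (hLh : Lh ≤ L) (hlz0 : 0 ≤ lz) (hlz : 1 + lz ≤ 2 * L) (hy : 0 < y)
    (hzz0 : 0 ≤ zz) (hzy : zz * L ^ (j + m) ≤ y) (hI'0 : 0 ≤ I') (hI' : I' ≤ 3 * L ^ (n + 1)) :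
    4 * hi * Lh ^ j * (Δ ^ 2 * I' * (1 + lz) + 4 * zz / y) ≤ 40 * X / L ^ m := by
  have hL0 : 0 < L := by linarith
  have hLm0 : 0 < L ^ m := by positivity
  have hLn0 : 0 < L ^ n := by positivity
  have hΔ0 : 0 < Δ := by rw [hΔ]; positivity
  have hΔL : Δ * L ^ n = 1 := by rw [hΔ]; exact inv_mul_cancel₀ hLn0.ne'
  have hΔI : Δ * I' ≤ 3 * L :=
    calc Δ * I' ≤ Δ * (3 * L ^ (n + 1)) := mul_le_mul_of_nonneg_left hI' hΔ0.le
      _ = 3 * L * (Δ * L ^ n) := by rw [pow_succ]; ring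
      _ = 3 * L := by rw [hΔL, mul_one]
  have hLhj : Lh ^ j ≤ L ^ j := pow_le_pow_left₀ hLh0 hLh j
  have hb : L ^ j * (Δ ^ 2 * I' * (1 + lz)) ≤ 6 / L ^ m := by
    have h1 : Δ ^ 2 * I' * (1 + lz) ≤ Δ * (3 * L) * (2 * L) := by
      have e : Δ ^ 2 * I' = Δ * (Δ * I') := by ring
      rw [e]
      exact mul_le_mul (mul_le_mul_of_nonneg_left hΔI hΔ0.le) hlz (by linarith) (by positivity)
    have h2 : L ^ j * (Δ * (3 * L) * (2 * L)) ≤ 6 / L ^ m := by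
      have e1 : L ^ j * (Δ * (3 * L) * (2 * L)) = 6 * (L ^ j * L ^ 2) / L ^ n := by
        rw [hΔ]; ring
      rw [e1, div_le_div_iff₀ hLn0 hLm0]
      have e2 : L ^ n = L ^ j * L ^ 2 * L ^ m * L := by
        rw [hn, show m + j + 3 = j + 2 + m + 1 by omega, pow_add, pow_add, pow_add, pow_one]
      rw [e2]
      have h0 : 0 ≤ L ^ j * L ^ 2 * L ^ m := by positivity
      nlinarith [mul_le_mul_of_nonneg_left hL h0]
    exact (mul_le_mul_of_nonneg_left h1 (by positivity)).trans h2
  have hc : L ^ j * (4 * zz / y) ≤ 4 / L ^ m := by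
    rw [mul_div_assoc', div_le_div_iff₀ hy hLm0]
    have : zz * (L ^ j * L ^ m) ≤ y := by rw [← pow_add]; exact hzy
    nlinarith
  have hbr0 : 0 ≤ Δ ^ 2 * I' * (1 + lz) + 4 * zz / y := by positivity
  calc 4 * hi * Lh ^ j * (Δ ^ 2 * I' * (1 + lz) + 4 * zz / y)
      ≤ 4 * X * L ^ j * (Δ ^ 2 * I' * (1 + lz) + 4 * zz / y) := by
        refine mul_le_mul_of_nonneg_right ?_ hbr0
        exact mul_le_mul (mul_le_mul_of_nonneg_left hhi (by norm_num)) hLhj (by positivity)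
          (by positivity)
    _ = 4 * X * (L ^ j * (Δ ^ 2 * I' * (1 + lz)) + L ^ j * (4 * zz / y)) := by ring
    _ ≤ 4 * X * (6 / L ^ m + 4 / L ^ m) :=
        mul_le_mul_of_nonneg_left (add_le_add hb hc) (by positivity)
    _ = 40 * X / L ^ m := by ring

/-- Class F: `2 C_F hi (log hi)^j (1+log z)^8 I' / (log V)^{A'} ≤ 1536·2^{A'} C_F X / L^A` for
`A' = A + (j+n+9)` and `log V ≥ L/2`. -/
theorem classF_numeric_le {L X hi Lh lz I' lV CF A : ℝ} {j n : ℕ} (hL : 1 ≤ L) (hX : 0 ≤ X)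
    (hhi : hi ≤ X) (hLh0 : 0 ≤ Lh) (hLh : Lh ≤ L) (hlz0 : 0 ≤ lz)
    (hlz : 1 + lz ≤ 2 * L) (hI'0 : 0 ≤ I') (hI' : I' ≤ 3 * L ^ (n + 1)) (hCF : 0 ≤ CF)
    (hlV : L / 2 ≤ lV) (hA : 0 < A) :
    2 * CF * hi * Lh ^ j * (1 + lz) ^ 8 * I' / lV ^ (A + (j + n + 9 : ℕ)) ≤
      1536 * 2 ^ (A + (j + n + 9 : ℕ)) * CF * X / L ^ A := by
  set A' : ℝ := A + (j + n + 9 : ℕ) with hA'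
  have hA'0 : 0 < A' := by positivity
  have hL0 : 0 < L := by linarith
  have hlV0 : 0 < lV := by linarith
  have hlVA : 0 < lV ^ A' := Real.rpow_pos_of_pos hlV0 _
  have hLA : 0 < L ^ A := Real.rpow_pos_of_pos hL0 _
  have hden : L ^ A' ≤ 2 ^ A' * lV ^ A' := by
    have h1 : (L / 2) ^ A' ≤ lV ^ A' := Real.rpow_le_rpow (by positivity) hlV hA'0.le
    rw [Real.div_rpow hL0.le (by norm_num), div_le_iff₀ (by positivity)] at h1
    linarith
  have hLA' : L ^ A' = L ^ A * L ^ (j + n + 9) := by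
    rw [hA', Real.rpow_add hL0, Real.rpow_natCast]
  have hnum : 2 * CF * hi * Lh ^ j * (1 + lz) ^ 8 * I' ≤ 1536 * CF * X * L ^ (j + n + 9) := by
    have h1 : (1 + lz) ^ 8 ≤ (2 * L) ^ 8 := pow_le_pow_left₀ (by linarith) hlz 8
    have hLhj : Lh ^ j ≤ L ^ j := pow_le_pow_left₀ hLh0 hLh j
    calc 2 * CF * hi * Lh ^ j * (1 + lz) ^ 8 * I'
        ≤ 2 * CF * X * L ^ j * (2 * L) ^ 8 * (3 * L ^ (n + 1)) := by gcongr
      _ = 1536 * CF * X * L ^ (j + n + 9) := by ring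
  rw [div_le_div_iff₀ hlVA hLA]
  calc 2 * CF * hi * Lh ^ j * (1 + lz) ^ 8 * I' * L ^ A
      ≤ 1536 * CF * X * L ^ (j + n + 9) * L ^ A := mul_le_mul_of_nonneg_right hnum hLA.le
    _ = 1536 * CF * X * L ^ A' := by rw [hLA']; ring
    _ ≤ 1536 * CF * X * (2 ^ A' * lV ^ A') := mul_le_mul_of_nonneg_left hden (by positivity)
    _ = 1536 * 2 ^ A' * CF * X * lV ^ A' := by ring

/-! ### 2. The large-cofactor bound -/

/-- **Regime (1b), large cofactors (F4c).**  For the family `r₀ = 1`, or `r₀ = 2` with `a`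
even, with `a` prime to every modulus prime to `r₀`, for `0 < ε' ≤ 1/8` and every `A > 0`
there are `B' : ℕ`, `C ≥ 0`, `X₀` such that for `X ≥ X₀` and all `lo, hi, y, z, K₀, K` with
`0 < hi ≤ X`, `lo ≤ K₀ + 1`, `X^{4ε'} ≤ K₀`, `1 ≤ z`, `y ≤ X`, `z² (log X)^{B'} ≤ y`,
`2z X^{ε'} ≤ y`:
`∑_{q ≤ z} |∑_{K₀ < k ≤ K, (k,r₀)=1} innerP j r₀ lo hi y a q k| ≤ C X / (log X)^A`. -/
theorem sum_abs_innerP_large_le (j : ℕ) {r₀ : ℕ} {a : ℤ}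
    (hfam : r₀ = 1 ∨ (r₀ = 2 ∧ (2 : ℤ) ∣ a)) (ha : ∀ q : ℕ, q.Coprime r₀ → IsCoprime (q : ℤ) a)
    {ε' : ℝ} (hε' : 0 < ε') (hε'1 : ε' ≤ 1 / 8) (A : ℝ) (hA : 0 < A) :
    ∃ B' : ℕ, ∃ C X₀ : ℝ, 0 ≤ C ∧ ∀ X : ℝ, X₀ ≤ X → ∀ lo hi y z K₀ K : ℕ,
      0 < hi → (hi : ℝ) ≤ X → lo ≤ K₀ + 1 → X ^ (4 * ε') ≤ K₀ → 1 ≤ z → (y : ℝ) ≤ X →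
      (z : ℝ) ^ 2 * Real.log X ^ B' ≤ y → 2 * z * X ^ ε' ≤ (y : ℝ) →
      ∑ q ∈ Icc 1 z, |∑ k ∈ Ioc K₀ K,
          (if k.Coprime r₀ then (1 : ℝ) else 0) * innerP j r₀ lo hi y a q k| ≤
        C * X / Real.log X ^ A := by
  have hr₀ : r₀ = 1 ∨ r₀ = 2 := hfam.imp_right And.left
  set m : ℕ := ⌈A⌉₊ with hm
  set n : ℕ := m + j + 3 with hn
  set A' : ℝ := A + (j + n + 9 : ℕ) with hA'
  have hA'0 : 0 < A' := by positivity
  obtain ⟨n₁, CF, X₂, hCF, hfree⟩ := free_box_input j hr₀ ha hε' hε'1 hA'0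
  have hE := ((((eventually_mul_rpow_mul_log_rpow_le (show (0 : ℝ) < 4 * ε' by positivity)
      n 2 one_pos).and (eventually_mul_rpow_mul_log_rpow_le hε' n 1 one_pos)).and
    (eventually_mul_rpow_mul_log_rpow_le (show (1 / 2 : ℝ) < 1 by norm_num) ((j + n + m : ℕ))
      56 one_pos)).and ((eventually_ge_atTop (9 : ℝ)).and (eventually_ge_atTop X₂)))
  obtain ⟨X₀, hX₀⟩ := Filter.eventually_atTop.1 hE
  refine ⟨2 * n₁ + j + n + m, 121 + 1536 * 2 ^ A' * CF, X₀, by positivity, ?_⟩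
  intro X hX lo hi y z K₀ K hhi hhiX hlo hK₀ hz hyX hzy hzε
  obtain ⟨⟨⟨hE1, hE2⟩, hE3⟩, hX9, hX₂⟩ := hX₀ X hX
  have hX1 : (1 : ℝ) ≤ X := by linarith
  have hX0 : (0 : ℝ) ≤ X := by linarith
  set L : ℝ := Real.log X with hL
  have hL2 : 2 ≤ L := two_le_log_of_nine_le hX9
  have hL1 : 1 ≤ L := by linarith
  have hL0 : 0 < L := by linarith
  rw [Real.rpow_zero, Real.rpow_natCast] at hE1 hE2
  rw [Real.rpow_natCast, Real.rpow_one] at hE3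
  -- hE1 : 2 * 1 * L ^ n ≤ 1 * X ^ (4ε'); hE2 : 1 * 1 * L ^ n ≤ 1 * X ^ ε';
  -- hE3 : 56 * X ^ (1/2) * L ^ (j+n+m) ≤ 1 * X
  have hLn1 : 1 ≤ L ^ n := one_le_pow₀ hL1
  have hLn0 : 0 < L ^ n := by positivity
  set Δ : ℝ := (L ^ n)⁻¹ with hΔ
  have hΔ0 : 0 < Δ := by positivity
  have hΔ1 : Δ ≤ 1 := inv_le_one_of_one_le₀ hLn1
  have hΔL : Δ * L ^ n = 1 := inv_mul_cancel₀ hLn0.ne'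
  -- parameter facts
  have hz' : (1 : ℝ) ≤ z := by exact_mod_cast hz
  have hz0 : (0 : ℝ) < z := by linarith
  have hLB : 1 ≤ L ^ (2 * n₁ + j + n + m) := one_le_pow₀ hL1
  have hzzy : (z : ℝ) ^ 2 ≤ y := le_trans (le_mul_of_one_le_right (by positivity) hLB) hzy
  have hzsq : (z : ℝ) ≤ (z : ℝ) ^ 2 := by nlinarith
  have hzy_nat : z ≤ y := by exact_mod_cast hzsq.trans hzzy
  have hzX : (z : ℝ) ≤ X := (hzsq.trans hzzy).trans hyX
  have hy0 : (0 : ℝ) < y := lt_of_lt_of_le (by positivity) hzzy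
  have hK₀Δ : 2 ≤ Δ * K₀ := by
    have h1 : 2 * L ^ n ≤ K₀ := le_trans (by linarith) hK₀
    calc (2 : ℝ) = Δ * L ^ n * 2 := by rw [hΔL, one_mul]
      _ = Δ * (2 * L ^ n) := by ring
      _ ≤ Δ * K₀ := mul_le_mul_of_nonneg_left h1 hΔ0.le
  have hzΔ : 2 * (z : ℝ) ≤ Δ * y := by
    have h1 : 2 * z * L ^ n ≤ y :=
      le_trans (mul_le_mul_of_nonneg_left (by linarith) (by positivity)) hzε
    calc 2 * (z : ℝ) = Δ * L ^ n * (2 * z) := by rw [hΔL, one_mul]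
      _ = Δ * (2 * z * L ^ n) := by ring
      _ ≤ Δ * y := mul_le_mul_of_nonneg_left h1 hΔ0.le
  -- `V`, the moduli set, the box counts
  set V : ℝ := X ^ (1 / 2 : ℝ) + (z : ℝ) ^ 2 * L ^ (2 * n₁) with hV
  have h3 : (3 : ℝ) ≤ X ^ (1 / 2 : ℝ) := le_rpow_half_of_sq_le (by norm_num) (by linarith)
  have hV0 : 0 ≤ V := by positivity
  have hV1 : 1 < V := by
    have : (0 : ℝ) ≤ (z : ℝ) ^ 2 * L ^ (2 * n₁) := by positivity
    linarith
  have hlogV : L / 2 ≤ Real.log V := by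
    have h1 : Real.log (X ^ (1 / 2 : ℝ)) = L / 2 := by
      rw [Real.log_rpow (by linarith), hL]; ring
    rw [← h1]
    exact Real.log_le_log (by positivity) (le_add_of_nonneg_right (by positivity))
  set Q : Finset ℕ := (Icc 1 z).filter (fun q : ℕ => q.Coprime r₀) with hQ
  have hQsub : Q ⊆ Icc 1 z := filter_subset _ _
  set I : ℕ := ⌊2 * Real.log K / Δ⌋₊ + 1 with hI
  set I' : ℕ := ⌊2 * Real.log hi / Δ⌋₊ + 1 with hI'
  have hKI : (K : ℝ) < (1 + Δ) ^ I := by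
    rcases Nat.eq_zero_or_pos K with hK0 | hKpos
    · rw [hK0, Nat.cast_zero]; positivity
    · exact lt_one_add_pow_boxCount hΔ0 hΔ1 (by exact_mod_cast hKpos)
  have hhiI' : (hi : ℝ) < (1 + Δ) ^ I' := lt_one_add_pow_boxCount hΔ0 hΔ1 (by exact_mod_cast hhi)
  -- Step 1: the moduli not prime to `r₀` contribute nothing
  have hS0 : ∀ q ∈ Icc 1 z, q ∉ Q → ∑ k ∈ Ioc K₀ K,
      (if k.Coprime r₀ then (1 : ℝ) else 0) * innerP j r₀ lo hi y a q k = 0 := by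
    intro q hq hqQ
    have hncop : ¬ q.Coprime r₀ := fun h => hqQ (mem_filter.2 ⟨hq, h⟩)
    rcases hfam with h1 | ⟨h2, ha2⟩
    · exact absurd (by rw [h1]; exact Nat.coprime_one_right q) hncop
    · subst h2
      have hq2 : 2 ∣ q := by
        by_contra h
        exact hncop ((Nat.Prime.coprime_iff_not_dvd Nat.prime_two).2 h).symm
      refine sum_eq_zero fun k _ => ?_
      split_ifs with hk
      · rw [innerP_eq_zero_of_even hq2 ha2 hk, mul_zero]
      · rw [zero_mul]
  have hred : ∑ q ∈ Icc 1 z, |∑ k ∈ Ioc K₀ K,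
      (if k.Coprime r₀ then (1 : ℝ) else 0) * innerP j r₀ lo hi y a q k| =
      ∑ q ∈ Q, |∑ k ∈ Ioc K₀ K,
        (if k.Coprime r₀ then (1 : ℝ) else 0) * innerP j r₀ lo hi y a q k| := by
    rw [hQ, sum_filter]
    refine sum_congr rfl fun q hq => ?_
    by_cases hc : q.Coprime r₀
    · rw [if_pos hc]
    · rw [if_neg hc, hS0 q hq (fun h => hc (mem_filter.1 h).2), abs_zero]
  rw [hred]
  -- Step 2: box decomposition and the four classes, per modulus
  set t : ℕ → ℕ → ℕ → ℝ := fun q i l =>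
    (if (K₀ : ℝ) < boxHigh (K : ℝ) Δ i ∧ 1 ≤ boxHigh (hi : ℝ) Δ l ∧
        ((y / q : ℕ) : ℝ) < boxHigh (hi : ℝ) Δ l ∧ boxLow (K : ℝ) Δ i * boxLow (hi : ℝ) Δ l ≤ hi ∧
        boxLow (K : ℝ) Δ i * boxLow (hi : ℝ) Δ l < V then boxTriv j hi K Δ q i l else 0) +
    (if (K₀ : ℝ) < boxHigh (K : ℝ) Δ i ∧ 1 ≤ boxHigh (hi : ℝ) Δ l ∧
        ((y / q : ℕ) : ℝ) < boxHigh (hi : ℝ) Δ l ∧ boxLow (K : ℝ) Δ i * boxLow (hi : ℝ) Δ l ≤ hi ∧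
        boxLow (hi : ℝ) Δ l < ((y / q : ℕ) : ℝ) then boxTriv j hi K Δ q i l else 0) +
    (if (K₀ : ℝ) < boxHigh (K : ℝ) Δ i ∧ ((y / q : ℕ) : ℝ) ≤ boxLow (hi : ℝ) Δ l ∧
        boxLow (K : ℝ) Δ i * boxLow (hi : ℝ) Δ l ≤ hi ∧
        (hi : ℝ) < (1 + Δ) ^ 2 * (boxLow (K : ℝ) Δ i * boxLow (hi : ℝ) Δ l)
      then boxTriv j hi K Δ q i l else 0) +
    (if (K₀ : ℝ) < boxHigh (K : ℝ) Δ i ∧ ((y / q : ℕ) : ℝ) ≤ boxLow (hi : ℝ) Δ l ∧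
        (1 + Δ) ^ 2 * (boxLow (K : ℝ) Δ i * boxLow (hi : ℝ) Δ l) ≤ hi ∧
        V ≤ boxLow (K : ℝ) Δ i * boxLow (hi : ℝ) Δ l
      then |freeSum j r₀ hi a K₀ K Δ q i l| else 0) with ht
  have hper : ∀ q ∈ Q, |∑ k ∈ Ioc K₀ K,
      (if k.Coprime r₀ then (1 : ℝ) else 0) * innerP j r₀ lo hi y a q k| ≤
      ∑ i ∈ range I, ∑ l ∈ range I', t q i l := by
    intro q hq
    obtain ⟨hqI, hcop⟩ := mem_filter.1 hq
    have hq1 : 0 < q := (mem_Icc.1 hqI).1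
    rw [sum_innerP_eq_sum_boxSum hΔ0 hKI hhiI' hlo j r₀ y a q]
    refine (abs_sum_le_sum_abs _ _).trans (sum_le_sum fun i _ => ?_)
    refine (abs_sum_le_sum_abs _ _).trans (sum_le_sum fun l _ => ?_)
    exact abs_boxSum_le_classes hΔ0 hq1 (ha q hcop) j r₀ hi y K₀ K i l V
  -- Step 3: the four class totals
  have hT := sum_classT_le j hΔ0 hΔ1 hhi hK₀Δ hz hzzy hV0 hQsub I I' (K := K)
  have hP := sum_classP_le j hΔ0 hΔ1 hhi hK₀Δ hz hzzy hQsub I I' (K := K)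
  have hH := sum_classH_le j hΔ0 hΔ1 hhi hK₀Δ hz hzzy hQsub I I' (K := K)
  have hZ0 : (0 : ℝ) ≤ (1 + Real.log z) ^ 8 := by positivity
  have hF := sum_classF_le j r₀ a hΔ0 hΔ1 hhi K K₀ hzy_nat hV1 hCF hZ0 hA'0.le hQsub I I'
    (fun i l h1 h2 h3 h4 => hfree X hX₂ hi y z K₀ K Δ hΔ0 hΔ1 hhi hhiX hK₀Δ hK₀ hz hzε hzΔ
      i l h1 h2 h3 h4)
  have hTot : ∑ q ∈ Q, ∑ i ∈ range I, ∑ l ∈ range I', t q i l ≤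
      4 * V * Real.log hi ^ j * (Δ * I' * (1 + Real.log z) + 8 / Δ) +
      4 * hi * Real.log hi ^ j * (Δ * (1 + Real.log z) + 4 * (z : ℝ) ^ 2 / y) +
      4 * hi * Real.log hi ^ j * (Δ ^ 2 * I' * (1 + Real.log z) + 4 * (z : ℝ) ^ 2 / y) +
      2 * CF * hi * Real.log hi ^ j * (1 + Real.log z) ^ 8 * I' / Real.log V ^ A' := by
    simp only [ht, sum_add_distrib]
    exact add_le_add (add_le_add (add_le_add hT hP) hH) hF
  -- Step 4: bookkeeping
  have hLh0 : 0 ≤ Real.log hi := Real.log_natCast_nonneg hi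
  have hLh : Real.log hi ≤ L := log_natCast_le_log hX1 hhiX
  have hlz0 : 0 ≤ Real.log z := Real.log_natCast_nonneg z
  have hlz : 1 + Real.log z ≤ 2 * L := by
    have := log_natCast_le_log hX1 hzX; linarith
  have hI'0 : (0 : ℝ) ≤ (I' : ℝ) := Nat.cast_nonneg I'
  have hI'le : ((I' : ℕ) : ℝ) ≤ 3 * L ^ (n + 1) := boxCount_le_of hL1 hΔ hLh0 hLh
  have hn2 : 2 ≤ n := by omega
  have hzyjm : (z : ℝ) ^ 2 * L ^ (j + m) ≤ y :=
    le_trans (mul_le_mul_of_nonneg_left (pow_le_pow_right₀ hL1 (by omega)) (by positivity)) hzy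
  have hE3' : 56 * X ^ (1 / 2 : ℝ) * L ^ (j + n + m) ≤ X := by linarith
  have hT' := (classT_numeric_le (j := j) hL1 hn2 hΔ hV0 hLh0 hLh hlz0 hlz hI'0 hI'le).trans
    (classT_split_le (j := j) (n := n) hL1 hyX hE3' hzy)
  have hP' := classP_numeric_le (j := j) hL1 hn hΔ hX0 hhiX hLh0 hLh hlz0 hlz hy0
    (by positivity) hzyjm
  have hH' := classH_numeric_le (j := j) hL1 hn hΔ hX0 hhiX hLh0 hLh hlz0 hlz hy0
    (by positivity) hzyjm hI'0 hI'le
  have hF' := classF_numeric_le (j := j) (n := n) hL1 hX0 hhiX hLh0 hLh hlz0 hlz hI'0 hI'le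
    hCF hlogV hA
  have hLA : 0 < L ^ A := Real.rpow_pos_of_pos hL0 A
  have hmA : X / L ^ m ≤ X / L ^ A := by
    refine div_le_div_of_nonneg_left hX0 hLA ?_
    calc L ^ A ≤ L ^ (m : ℝ) := Real.rpow_le_rpow_of_exponent_le hL1 (Nat.le_ceil A)
      _ = L ^ m := Real.rpow_natCast L m
  have h121 : 57 * X / L ^ m + 24 * X / L ^ m + 40 * X / L ^ m ≤ 121 * (X / L ^ A) := by
    have e : 57 * X / L ^ m + 24 * X / L ^ m + 40 * X / L ^ m = 121 * (X / L ^ m) := by ring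
    rw [e]; exact mul_le_mul_of_nonneg_left hmA (by norm_num)
  calc ∑ q ∈ Q, |∑ k ∈ Ioc K₀ K,
          (if k.Coprime r₀ then (1 : ℝ) else 0) * innerP j r₀ lo hi y a q k|
      ≤ ∑ q ∈ Q, ∑ i ∈ range I, ∑ l ∈ range I', t q i l := sum_le_sum hper
    _ ≤ _ := hTot
    _ ≤ 57 * X / L ^ m + 24 * X / L ^ m + 40 * X / L ^ m + 1536 * 2 ^ A' * CF * X / L ^ A := by
        linarith
    _ ≤ 121 * (X / L ^ A) + 1536 * 2 ^ A' * CF * X / L ^ A := by linarith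
    _ = (121 + 1536 * 2 ^ A' * CF) * X / Real.log X ^ A := by rw [hL]; ring

end Summit.Parity.BatemanHorn.Theorems
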